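import Summits.AtomisticToContinuum.HydrodynamicLimit.Theses.TwoClocks
import Summits.AtomisticToContinuum.HydrodynamicLimit.Theorems.TwoClocksAssemblyReductionsStatics
import Summits.AtomisticToContinuum.HydrodynamicLimit.Theorems.KineticFluxLdDecay.Negative.GibbsTilts
import Summits.AtomisticToContinuum.HydrodynamicLimit.Theorems.KineticCurrentsWindowLDUniform.Negative.ForallN
import Literature.MathematicalPhysics.KineticTheory.HardSphereEulerLLN

/-!
# Disproof of `TransferEntropyClock` (stmt-AtomisticToContinuum-16625) — work file of the standing disprover

Crux (route TwoClocks, rank 11, verbatim):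
`TransferEntropyClock := KineticWindowLDUniform → ClampedTransferWindowLD → TransferActivityTails →
EnergyCurrentTails → DiluteSelfConsistency → _root_.HydrodynamicLimit`
(rev-10 restatement of `ClampedEntropyClock` stmt-15145, which closed VACUOUSLY through the Lean refutation of
its antecedent stmt-13733; predecessor work file `Cruxes/ClampedEntropyClock/Disproof.lean`, whose §1–§4 port
verbatim with the names changed).

FINDINGS (cycle 1, refuter-cdisprove-stmt-AtomisticToContinuum-16625-0, 2026-08-16):

* NO KILL OF THE CRUX ITSELF, with the kernel-checked reason (§1, landed as
  `Theorems/TransferEntropyClock/Negative/RefutationReducesToSummit.lean`, p127831):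
  `¬ TransferEntropyClock ↔ (KWLDU ∧ C′ ∧ TAT ∧ ECT ∧ DSC ∧ ¬ HydrodynamicLimit)`; the crux is sandwiched
  `HydrodynamicLimit → crux`, and so is every `Without<H>` weakening (§3) — no `_false_without_` theorem exists
  for anyone who cannot refute the summit conjunct. With the proved statics the crux is EQUIVALENT to the
  Assembly item stmt-16626 (`twoClocksAssembly_iff_transferEntropyClock`, landed by a prover) and is closed by
  the entropy target `RelEntropyVanishing` (§4).
* VACUITY HAZARD (§2): `¬ antecedent → crux` for each of the five antecedents. The two NEW antecedents
  (C′ = `ClampedTransferWindowLD` stmt-16623, `TransferActivityTails` stmt-16624) have their own disprover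
  seats; from this seat: C′ SURVIVES every flow-invariant (homogeneous Gibbs) tilt — drift/temperature tilts
  have zero gain on the EOS-centred collisional rows at constant profiles by 𝕋³-translation invariance
  (`E[∂_kφ(x₁)] = ∫∂_kφ = 0`), and its `∃ β₀` is chosen after `θ₀, V, φ` — so no cheap vacuity is in sight.
* MAIN NEGATIVE RESULT (§5, landed as `Theorems/TransferEntropyClock/Negative/AllBetaKineticChildFalse.lean`,
  p127781): THE `∀ β` RE-TYPING OF THE KINETIC CHILD IS FALSE. Three seats around this crux converged on the
  same repair of the energy-row bookkeeping — the docking node for BOUNDED fast functionals in the shape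
  `∀ β ∀ ε ∃ τ ∃ N₀` (R1 `QuenchedCellClock.KineticWindowLDUniformBounded` of the 15145 restated clock,
  the predecessor disprover's R1 / `EnergyRowShapes.allBeta_gronwallBound_small`, ideator 2's
  `KineticWindowLDBoundedAllBeta`, first antecedent of `TaggedNetClock`). It is refuted for EVERY window and
  EVERY `N` by Donsker–Varadhan with an INVARIANT drift tilt (the tree's `KineticFluxLdDecayTilt.tilt_lower_bound`):
  `(N+1)⁻¹ log ∫ e^{β Σᵢ w⁻¹∫₀ʷ F} dG_N ≥ β·E_{N(u₁,1)}F − |u₁|²/2`, witness `F = 8(cos v₁ − cos v₀) ⊥ {1, v, |v|²}`,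
  `u₁ = e₀`, `β = 2`, `ε = 1`. MORAL: orthogonality to the collision invariants is first order; the tilt sees
  the SECOND-ORDER response of `F` to the conserved parameters `(u, θ)`, so any window-LD node holds at most for
  `|β| ≤ β₀ ≲ (entropy-cost curvature)/(second-order equilibrium response of F)`. Consequences: (i) every clock
  typed on a `∀ β` kinetic node (`TaggedNetClock`, `ClampedEntropyClockRestated`) is VACUOUSLY true and feeds
  nothing (§5, `allBeta_antecedent_vacuous`); (ii) the consistent repair of the energy row is a tilt threshold
  UNIFORM ALONG THE TRUNCATION FAMILY `F_M` of one fixed quadratic-growth functional (the second-order response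
  of `F_M` is `M`-uniform, so this is plausible where `∀ β` is false), typed `∃ β₀ ∀ M ≥ M₀ ∀ |β| ≤ β₀ …`;
  (iii) for the node at NORMALISED functionals (`|F| ≤ 1`, say) a UNIVERSAL small `β₀` is NOT excluded by tilts
  (gain of the best homogeneous tilt is second order with a bounded coefficient, cost is second order with
  coefficient `1/2`) — that is the only `β`-uniform shape this seat cannot break.
* NEAR-MISS (§6, sorried, paper proof in the docstring): the `∀ β` COLLISIONAL child
  (`LocalClampedTransferWindowLDAllBeta` of ideator 2) is also false. At constant profiles invariant tilts do not bite
  (translation invariance), but the node is LOCAL: against a reference with an inhomogeneous velocity profile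
  `u₀(x) = ∂₀φ(x) e₁` the HOMOGENEOUS drift tilt `G_s` (flow-invariant) gains through the uncentred second-order cross
  term `−(2/3)(Z̄−1) s ∫(∂₀φ)²` of the EOS projection `A`, at cost `½(s² + ∫(∂₀φ)²)`, and `∀ β` beats it
  (per-particle pressure `≥ ½β²(4π²/3)²(Z̄−1)² − |β|πV₀ − π² → ∞`). All ingredients are in the tree (tilt identity,
  invariance + Fubini, uniform one-point marginal `integral_mul_shiftInvariant`, pathwise clamp bound, energy
  conservation, `rhoLim_uniform`); ≈ 800 lines, deferred. PLANNER: do not type the collisional child `∀ β` either; keep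
  `∃ V₀ ∀ V ∃ β₀` (β₀ after V, the profiles, φ) as in C′.
* ORDER-OF-LIMITS / UNIFORMITY (inherited, still binding): pointwise thresholds of KWLDU / C′ do not net along the
  Euler reference family (`LocalityRowShapes`, `EnergyRowShapes`, ideator notes r1); the tilt finding above adds
  the constraint from the other side — thresholds cannot be made `β`-free. The window between "pointwise" and
  "∀β" is: β₀ explicit in the data `(sup θ, sup |u|, ‖F‖_w, second-order response)`, uniform along compact
  profile families and truncation families.

Nothing outside §6 is sorried.
-/

noncomputable section

namespace Summit.AtomisticToContinuum.HydrodynamicLimit.Cruxes.TransferEntropyClock.Disproof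

open MeasureTheory ProbabilityTheory Real
open scoped ENNReal InnerProductSpace
open Literature.MathematicalPhysics.KineticTheory Literature.Analysis.FluidPDE Literature.Analysis.FunctionSpaces
open Summit.AtomisticToContinuum.HydrodynamicLimit.Theses.TwoClocks
open Summit.AtomisticToContinuum.HydrodynamicLimit.Theorems
open KineticFluxLdDecayTilt

/-! ## §1 Structure: what a refutation of the crux would have to be -/

/-- The crux, uncurried: the five inputs jointly imply the Statement. [folklore] -/
theorem transferEntropyClock_iff :
    TransferEntropyClock ↔
      (KineticWindowLDUniform ∧ ClampedTransferWindowLD ∧ TransferActivityTails ∧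
        EnergyCurrentTails ∧ DiluteSelfConsistency → _root_.HydrodynamicLimit) := by
  unfold TransferEntropyClock
  constructor
  · rintro h ⟨hK, h₃, h₇, h₆, hS⟩
    exact h hK h₃ h₇ h₆ hS
  · intro h hK h₃ h₇ h₆ hS
    exact h ⟨hK, h₃, h₇, h₆, hS⟩

/-- **The Statement implies the crux** (the crux is weaker than the summit conjunct). [folklore] -/
theorem transferEntropyClock_of_hydrodynamicLimit (h : _root_.HydrodynamicLimit) : TransferEntropyClock := by
  unfold TransferEntropyClock
  intro _ _ _ _ _
  exact h

/-- **Any refutation of the crux refutes the summit conjunct.** [folklore] -/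
theorem not_hydrodynamicLimit_of_not_transferEntropyClock (h : ¬ TransferEntropyClock) :
    ¬ _root_.HydrodynamicLimit :=
  fun hHL => h (transferEntropyClock_of_hydrodynamicLimit hHL)

/-- **Any refutation of the crux proves all five open antecedents.** [folklore] -/
theorem antecedents_of_not_transferEntropyClock (h : ¬ TransferEntropyClock) :
    KineticWindowLDUniform ∧ ClampedTransferWindowLD ∧ TransferActivityTails ∧
      EnergyCurrentTails ∧ DiluteSelfConsistency := by
  unfold TransferEntropyClock at h
  by_contra hc
  apply h
  intro hK h₃ h₇ h₆ hS
  exact absurd ⟨hK, h₃, h₇, h₆, hS⟩ hc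

/-- **The refutation problem, exactly.** `¬ TransferEntropyClock` is equivalent to: the five inputs hold AND
the summit conjunct fails. [folklore] -/
theorem not_transferEntropyClock_iff :
    ¬ TransferEntropyClock ↔
      (KineticWindowLDUniform ∧ ClampedTransferWindowLD ∧ TransferActivityTails ∧
        EnergyCurrentTails ∧ DiluteSelfConsistency ∧ ¬ _root_.HydrodynamicLimit) := by
  constructor
  · intro h
    obtain ⟨hK, h₃, h₇, h₆, hS⟩ := antecedents_of_not_transferEntropyClock h
    exact ⟨hK, h₃, h₇, h₆, hS, not_hydrodynamicLimit_of_not_transferEntropyClock h⟩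
  · rintro ⟨hK, h₃, h₇, h₆, hS, hHL⟩ hC
    exact hHL (hC hK h₃ h₇ h₆ hS)

/-! ## §2 Vacuity hazard: a refuted antecedent PROVES the crux (ex falso)

The two live candidates are the NEW antecedents C′ (stmt-16623) and `TransferActivityTails` (stmt-16624),
each with its own disprover seat. -/

/-- `¬ KineticWindowLDUniform` (the docking node, stmt-14442) closes the crux vacuously. [folklore] -/
theorem transferEntropyClock_of_not_kineticWindowLDUniform (h : ¬ KineticWindowLDUniform) :
    TransferEntropyClock := by
  unfold TransferEntropyClock
  intro hK
  exact absurd hK h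

/-- `¬ ClampedTransferWindowLD` (C′, stmt-16623) closes the crux vacuously. [folklore] -/
theorem transferEntropyClock_of_not_clampedTransferWindowLD (h : ¬ ClampedTransferWindowLD) :
    TransferEntropyClock := by
  unfold TransferEntropyClock
  intro _ h₃
  exact absurd h₃ h

/-- `¬ TransferActivityTails` (stmt-16624) closes the crux vacuously. [folklore] -/
theorem transferEntropyClock_of_not_transferActivityTails (h : ¬ TransferActivityTails) :
    TransferEntropyClock := by
  unfold TransferEntropyClock
  intro _ _ h₇
  exact absurd h₇ h

/-- `¬ EnergyCurrentTails` (stmt-9235) closes the crux vacuously. [folklore] -/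
theorem transferEntropyClock_of_not_energyCurrentTails (h : ¬ EnergyCurrentTails) : TransferEntropyClock := by
  unfold TransferEntropyClock
  intro _ _ _ h₆
  exact absurd h₆ h

/-- `¬ DiluteSelfConsistency` (stmt-3091) closes the crux vacuously. [folklore] -/
theorem transferEntropyClock_of_not_diluteSelfConsistency (h : ¬ DiluteSelfConsistency) :
    TransferEntropyClock := by
  unfold TransferEntropyClock
  intro _ _ _ _ hS
  exact absurd hS h

/-! ## §3 Load-bearing analysis: the crux with one antecedent dropped

Each `Without<H>` still concludes the Statement, so `¬ Without<H>` is as unobtainable as `¬ HydrodynamicLimit`.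
Informal necessity (which Euler row each input feeds in Yau's Gronwall, OllaVaradhanYau1993 §3):
`KineticWindowLDUniform` — kinetic stress / heat currents (momentum + energy rows); `ClampedTransferWindowLD` —
collisional momentum / energy transfer (the `p_ex` part of both rows); `TransferActivityTails` — the clamp
remainder in L¹ under the TRUE law; `EnergyCurrentTails` — the cubic heat-flux truncation (energy row only);
`DiluteSelfConsistency` — keeps the reference local Gibbs law in the convergent cluster regime (every row). -/

/-- The crux without the docking node. [folklore] -/
def WithoutKWLDU : Prop :=
  ClampedTransferWindowLD → TransferActivityTails → EnergyCurrentTails → DiluteSelfConsistency →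
    _root_.HydrodynamicLimit

/-- The crux without the clamped collisional LD. [folklore] -/
def WithoutCTWLD : Prop :=
  KineticWindowLDUniform → TransferActivityTails → EnergyCurrentTails → DiluteSelfConsistency →
    _root_.HydrodynamicLimit

/-- The crux without the transfer-activity tails. [folklore] -/
def WithoutTAT : Prop :=
  KineticWindowLDUniform → ClampedTransferWindowLD → EnergyCurrentTails → DiluteSelfConsistency →
    _root_.HydrodynamicLimit

/-- The crux without the cubic energy-current tails. [folklore] -/
def WithoutECT : Prop :=
  KineticWindowLDUniform → ClampedTransferWindowLD → TransferActivityTails → DiluteSelfConsistency →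
    _root_.HydrodynamicLimit

/-- The crux without dilute self-consistency. [folklore] -/
def WithoutDSC : Prop :=
  KineticWindowLDUniform → ClampedTransferWindowLD → TransferActivityTails → EnergyCurrentTails →
    _root_.HydrodynamicLimit

/-- Each weakening implies the crux… [folklore] -/
theorem transferEntropyClock_of_without :
    (WithoutKWLDU ∨ WithoutCTWLD ∨ WithoutTAT ∨ WithoutECT ∨ WithoutDSC) → TransferEntropyClock := by
  unfold TransferEntropyClock WithoutKWLDU WithoutCTWLD WithoutTAT WithoutECT WithoutDSC
  rintro (h | h | h | h | h) hK h₃ h₇ h₆ hS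
  exacts [h h₃ h₇ h₆ hS, h hK h₇ h₆ hS, h hK h₃ h₆ hS, h hK h₃ h₇ hS, h hK h₃ h₇ h₆]

/-- …and each is implied by the Statement, so none can be refuted without refuting the summit conjunct.
[folklore] -/
theorem without_of_hydrodynamicLimit (h : _root_.HydrodynamicLimit) :
    WithoutKWLDU ∧ WithoutCTWLD ∧ WithoutTAT ∧ WithoutECT ∧ WithoutDSC := by
  unfold WithoutKWLDU WithoutCTWLD WithoutTAT WithoutECT WithoutDSC
  exact ⟨fun _ _ _ _ => h, fun _ _ _ _ => h, fun _ _ _ _ => h, fun _ _ _ _ => h, fun _ _ _ _ => h⟩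

/-- The would-be `transferEntropyClock_false_without_DSC` is exactly "the other four inputs hold and
`HydrodynamicLimit` fails" (landed form: `TransferEntropyClockNegative.not_transferEntropyClock_withoutDSC_iff`).
[folklore] -/
theorem not_withoutDSC_iff :
    ¬ WithoutDSC ↔
      (KineticWindowLDUniform ∧ ClampedTransferWindowLD ∧ TransferActivityTails ∧
        EnergyCurrentTails ∧ ¬ _root_.HydrodynamicLimit) := by
  unfold WithoutDSC
  constructor
  · intro h
    by_contra hc
    apply h
    intro hK h₃ h₇ h₆
    by_contra hHL
    exact hc ⟨hK, h₃, h₇, h₆, hHL⟩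
  · rintro ⟨hK, h₃, h₇, h₆, hHL⟩ h
    exact hHL (h hK h₃ h₇ h₆)

/-! ## §4 Relation to the route's other composites (landed by provers; cited, not re-proved)

`twoClocksAssembly_iff_transferEntropyClock : Assembly ↔ TransferEntropyClock` (stmt-16626 ≡ stmt-16625,
`Theorems/TwoClocksAssemblyReductionsStatics.lean`); `twoClocksAssembly_of_hydrodynamicLimit`,
`twoClocksAssembly_of_not_input` (`Theorems/TwoClocksAssemblyReductions.lean`). -/

/-- **The entropy target closes the crux** with all five inputs idle: `RelEntropyVanishing` (stmt-0766) → crux,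
through the landed `entropyToHydro_proof` and the Statement file's bridge `HydrodynamicLimit.of_unguarded`.
[folklore] -/
theorem transferEntropyClock_of_relEntropyVanishing (hRE : RelEntropyVanishing) : TransferEntropyClock :=
  transferEntropyClock_of_hydrodynamicLimit (_root_.HydrodynamicLimit.of_unguarded (entropyToHydro_proof hRE))

/-- The crux and the rev-10 frame stand or fall together (prover-landed equivalence, restated). [folklore] -/
theorem transferEntropyClock_iff_assembly : TransferEntropyClock ↔ Assembly :=
  twoClocksAssembly_iff_transferEntropyClock.symm

/-! ## §5 The `∀ β` kinetic child is FALSE (landed: `Theorems/TransferEntropyClock/Negative/AllBetaKineticChildFalse.lean`)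

Kernel-checked here as well (same proof), so that this work file is self-contained for its readers.

Relation to the card `tagged-frozen-net-clock` §Cheapest falsifier (4) ("a mechanism keeping a bounded fast functional
atypical for `τσ² → ∞` collision times at β-INDEPENDENT cost per sphere would refute both ∀β nodes and, with them, every
relative-entropy route; collimated beams cost `≍ 2 log τ` per sphere → ∞: they do not"): the GALILEAN BOOST (and the
temperature shift) is exactly such a mechanism — cost `|u₁|²/2` per sphere, independent of `β`, `τ` and `N`, because the
boosted homogeneous Gibbs law is itself invariant: nothing has to be kept atypical against the collisions, the conserved
quantities do it. It refutes the `∀ β` typings and NOTHING ELSE: the gain is SECOND order in the boost (`F ⊥ v` kills the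
first order), so for `|β| ≤ β₀(F, θ)` the cost wins and every `∃ β₀` node of the route (KWLDU, crux 2, C′, the family
typings of 14680/9133) is untouched — relative-entropy routes for true hard spheres are not refuted by it. -/

/-- **A FALSE proposition — NOT a citable fact.** The `∀ β` kinetic docking node for BOUNDED fast functionals
(verbatim `QuenchedCellClock.KineticWindowLDUniformBounded` = ideator 2's `KineticWindowLDBoundedAllBeta`):
frame of `TwoClocks.KineticWindowLDUniform` (local Gibbs data, `η₀`-uniform packing guard, `F` continuous,
bounded, orthogonal at every `x` under `M_(1,u₀(x),θ₀(x))` to `1, v_j, |v|²`), conclusion `∀ β ∀ ε ∃ τ ∃ N₀`.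
Kept only as the statement that `not_kineticWindowLDBoundedAllBeta` negates (no provenance tag on purpose). -/
def KineticWindowLDBoundedAllBeta : Prop :=
  ∃ η₀ : ℝ, 0 < η₀ ∧ ∀ (a θ₀ : T3 → ℝ) (u₀ : T3 → V3), Continuous a → Continuous θ₀ → Continuous u₀ → (∀ x, 0 < a x) →
    (∀ x, 0 < θ₀ x) → ∀ σ : ℝ, 0 < σ → σ ^ 3 * (⨆ x, a x) ≤ η₀ * ∫ x, a x →
    ∀ Φ : (N : ℕ) → HardSphereFlow (Torus.geometry (Fin 3)) (hsDiameter σ N) (N + 1),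
    ∀ F : T3 × V3 → ℝ, Continuous F → (∃ C : ℝ, ∀ y, |F y| ≤ C) →
    (∀ x, ∫ v, F (x, v) * localMaxwellian 1 (θ₀ x) (u₀ x) v = 0) →
    (∀ x (j : Fin 3), ∫ v, F (x, v) * v j * localMaxwellian 1 (θ₀ x) (u₀ x) v = 0) →
    (∀ x, ∫ v, F (x, v) * ‖v‖ ^ 2 * localMaxwellian 1 (θ₀ x) (u₀ x) v = 0) →
    ∀ β : ℝ, ∀ ε : ℝ, 0 < ε → ∃ τ : ℝ, 0 < τ ∧ ∃ N₀ : ℕ, ∀ N : ℕ, N₀ ≤ N →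
      ∫⁻ z, ENNReal.ofReal (Real.exp (β * ∑ i : Fin (N + 1), (τ * ((N : ℝ) + 1) ^ (-(1 / 3 : ℝ)))⁻¹ *
          ∫ r in (0 : ℝ)..(τ * ((N : ℝ) + 1) ^ (-(1 / 3 : ℝ))), F (((Φ N).flow r z) i)))
        ∂(localGibbsLaw σ a u₀ θ₀ N (Φ N)) ≤ ENNReal.ofReal (Real.exp (ε * ((N : ℝ) + 1)))

/-! ### The witness functional `F(v) = 8 (cos v₁ − cos v₀)` -/

/-- The witness: `g(v) = 8 (cos v₁ − cos v₀)` (bounded, continuous). [folklore] -/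
def gTilt (v : V3) : ℝ := 8 * (Real.cos (v 1) - Real.cos (v 0))

/-- `g` is continuous. [folklore] -/
theorem continuous_gTilt : Continuous gTilt :=
  continuous_const.mul
    ((Real.continuous_cos.comp (continuous_coord 1)).sub (Real.continuous_cos.comp (continuous_coord 0)))

/-- `|g| ≤ 16`. [folklore] -/
theorem abs_gTilt_le (v : V3) : |gTilt v| ≤ 16 := by
  unfold gTilt
  rw [abs_mul]
  have h1 := Real.abs_cos_le_one (v 0)
  have h2 := Real.abs_cos_le_one (v 1)
  have : |Real.cos (v 1) - Real.cos (v 0)| ≤ 2 := by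
    calc _ ≤ |Real.cos (v 1)| + |Real.cos (v 0)| := abs_sub _ _
      _ ≤ 2 := by linarith
  norm_num
  nlinarith

/-- `g ⊥ span{1, ⟪b,·⟫, ‖·‖²}` under the standard Gaussian (swap symmetry `v₀ ↔ v₁` for the even part,
parity for the odd part). [folklore] -/
theorem integral_gTilt_mul_eq_zero (c₀ c₂ : ℝ) (b : V3) :
    ∫ v, gTilt v * (c₀ + inner ℝ b v + c₂ * ‖v‖ ^ 2) ∂stdGaussian V3 = 0 := by
  have hgc := continuous_gTilt
  have hgK := abs_gTilt_le
  have hsplit : ∀ v : V3, gTilt v * (c₀ + inner ℝ b v + c₂ * ‖v‖ ^ 2) =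
      gTilt v * (c₀ + c₂ * ‖v‖ ^ 2) + gTilt v * ⟪b, v⟫_ℝ := fun v => by ring
  simp_rw [hsplit]
  have hi1 : Integrable (fun v : V3 => gTilt v * (c₀ + c₂ * ‖v‖ ^ 2)) (stdGaussian V3) :=
    ((integrable_const c₀).add (integrable_norm_sq_stdGaussian.const_mul c₂)).bdd_mul
      hgc.aestronglyMeasurable (ae_of_all _ fun v => by rw [Real.norm_eq_abs]; exact hgK v)
  have hi2 : Integrable (fun v => gTilt v * ⟪b, v⟫_ℝ) (stdGaussian V3) :=
    (integrable_inner_stdGaussian b).bdd_mul hgc.aestronglyMeasurable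
      (ae_of_all _ fun v => by rw [Real.norm_eq_abs]; exact hgK v)
  rw [integral_add hi1 hi2,
    integral_eq_zero_of_odd_stdGaussian (f := fun v : V3 => gTilt v * ⟪b, v⟫_ℝ) fun v => by
      simp only [gTilt, PiLp.neg_apply, Real.cos_neg, inner_neg_right]; ring]
  have hanti : ∀ v : V3, gTilt (swap01 v) * (c₀ + c₂ * ‖swap01 v‖ ^ 2) =
      -(gTilt v * (c₀ + c₂ * ‖v‖ ^ 2)) := fun v => by
    rw [LinearIsometryEquiv.norm_map, gTilt, gTilt, swap01_apply_zero, swap01_apply_one]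
    ring
  have hinv := integral_comp_linearIsometryEquiv_stdGaussian swap01
    (fun v : V3 => gTilt v * (c₀ + c₂ * ‖v‖ ^ 2))
  simp only [hanti, integral_neg] at hinv
  linarith

/-- `g ⊥ 1` under `M_{1,0,1}`. [folklore] -/
theorem gTilt_orth_one : ∫ v, gTilt v * localMaxwellian 1 1 (0 : V3) v = 0 := by
  have h := integral_gTilt_mul_eq_zero 1 0 0
  simp only [inner_zero_left, add_zero, zero_mul, mul_one] at h
  rw [KineticCurrentsWindowLDUniformOneSphere.integral_mul_localMaxwellian_eq]
  exact h

/-- `g ⊥ v_j` under `M_{1,0,1}`. [folklore] -/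
theorem gTilt_orth_mom (j : Fin 3) : ∫ v, gTilt v * v j * localMaxwellian 1 1 (0 : V3) v = 0 := by
  have h := integral_gTilt_mul_eq_zero 0 0 (EuclideanSpace.single j 1)
  simp only [zero_add, zero_mul, add_zero, EuclideanSpace.inner_single_left, map_one, one_mul] at h
  rw [KineticCurrentsWindowLDUniformOneSphere.integral_mul_localMaxwellian_eq]
  exact h

/-- `g ⊥ ‖v‖²` under `M_{1,0,1}`. [folklore] -/
theorem gTilt_orth_energy : ∫ v, gTilt v * ‖v‖ ^ 2 * localMaxwellian 1 1 (0 : V3) v = 0 := by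
  have h := integral_gTilt_mul_eq_zero 0 1 0
  simp only [inner_zero_left, add_zero, zero_add, one_mul] at h
  rw [KineticCurrentsWindowLDUniformOneSphere.integral_mul_localMaxwellian_eq]
  exact h

/-! ### The refutation -/

/-- **THE `∀ β` KINETIC CHILD IS FALSE** (R1 = `KineticWindowLDUniformBounded` = `KineticWindowLDBoundedAllBeta`).
Witness: `η₀` arbitrary, `a = θ₀ = 1`, `u₀ = 0`, `σ = min(1/4, η₀, 1)`, the regular Alexander flows,
`F(x,v) = 8(cos v₁ − cos v₀)`, `β = 2`, `ε = 1`, `N = N₀`: by the invariant DRIFT tilt `u₁ = e₀`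
(`KineticFluxLdDecayTilt.tilt_lower_bound`) the per-particle pressure of the window functional is
`≥ 2 · 8e^{-1/2}(1 − cos 1) − 1/2 ≥ 43/12 − 1/2 > 1` at EVERY window and EVERY `N`. [folklore] -/
theorem not_kineticWindowLDBoundedAllBeta : ¬ KineticWindowLDBoundedAllBeta := by
  rintro ⟨η₀, hη₀, h⟩
  -- parameters
  set σ : ℝ := min (1 / 4) (min η₀ 1) with hσdef
  have hσpos : 0 < σ := lt_min (by norm_num) (lt_min hη₀ one_pos)
  have hσ4 : σ ≤ 1 / 4 := min_le_left _ _
  have hση : σ ≤ η₀ := (min_le_right _ _).trans (min_le_left _ _)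
  have hσ1 : σ ≤ 1 := (min_le_right _ _).trans (min_le_right _ _)
  have hσhalf' : σ < 2⁻¹ := hσ4.trans_lt (by norm_num)
  have hguard : σ ^ 3 * (⨆ _x : T3, (1 : ℝ)) ≤ η₀ * ∫ _x : T3, (1 : ℝ) := by
    have hsup : (⨆ _x : T3, (1 : ℝ)) = 1 := ciSup_const
    have hint : ∫ _x : T3, (1 : ℝ) = 1 := by simp
    rw [hsup, hint, mul_one, mul_one]
    calc σ ^ 3 ≤ σ := by
          have : σ ^ 3 ≤ σ ^ 1 := pow_le_pow_of_le_one hσpos.le hσ1 (by norm_num)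
          simpa using this
      _ ≤ η₀ := hση
  -- the flow family (regular Alexander flows) and the functional
  have hmain := h (fun _ => 1) (fun _ => 1) (fun _ => 0) continuous_const continuous_const
    continuous_const (fun _ => one_pos) (fun _ => one_pos) σ hσpos hguard (regFlowCrux hσpos hσhalf')
    (fun y => gTilt y.2)
    (continuous_gTilt.comp continuous_snd) ⟨16, fun y => abs_gTilt_le y.2⟩
    (fun _ => gTilt_orth_one) (fun _ j => gTilt_orth_mom j) (fun _ => gTilt_orth_energy) 2 1 one_pos
  obtain ⟨τ, hτ, N₀, hN⟩ := hmain
  have key := hN N₀ le_rfl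
  clear hN h
  -- the window
  set w : ℝ := τ * ((N₀ : ℝ) + 1) ^ (-(1 / 3 : ℝ)) with hw
  have hwpos : 0 < w := mul_pos hτ (Real.rpow_pos_of_pos (by positivity) _)
  -- interchange `∑ᵢ` and `∫₀ʷ`, absorb `β = 2` into the observable
  set g : V3 → ℝ := fun v => 2 * gTilt v with hg
  have hgc : Continuous g := continuous_const.mul continuous_gTilt
  have hgK : ∀ v, |g v| ≤ 32 := fun v => by
    rw [hg]; dsimp only; rw [abs_mul]
    have := abs_gTilt_le v
    norm_num
    linarith
  set Φ := regFlowCrux hσpos hσhalf' N₀ with hΦ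
  have hII : ∀ (z : Config (N₀ + 1) (Fin 3) T3) (i : Fin (N₀ + 1)),
      IntervalIntegrable (fun r => gTilt (Φ.flow r z i).2) volume 0 w := by
    intro z i
    have h2 : Measurable fun r : ℝ => (Φ.flow r z i).2 :=
      ((measurable_pi_apply i).comp (measurable_regFlowCrux_uncurry hσpos hσhalf' N₀).of_uncurry_right).snd
    have hm : Measurable fun r : ℝ => gTilt (Φ.flow r z i).2 := continuous_gTilt.measurable.comp h2
    refine (intervalIntegrable_const (c := (16 : ℝ))).mono_fun' hm.aestronglyMeasurable ?_
    exact ae_of_all _ fun r => by simpa [Real.norm_eq_abs] using abs_gTilt_le (Φ.flow r z i).2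
  have hpt : ∀ z : Config (N₀ + 1) (Fin 3) T3,
      2 * ∑ i : Fin (N₀ + 1), (w⁻¹ * ∫ r in (0 : ℝ)..w, gTilt ((Φ.flow r z) i).2) =
        w⁻¹ * ∫ s in (0 : ℝ)..w, ∑ i, 2 * gTilt ((Φ.flow s z i).2) := by
    intro z
    rw [intervalIntegral.integral_finsetSum (fun i _ => ((hII z i).const_mul 2))]
    simp only [intervalIntegral.integral_const_mul]
    rw [Finset.mul_sum, Finset.mul_sum]
    refine Finset.sum_congr rfl fun i _ => ?_
    ring
  have hEq : ∫⁻ z, ENNReal.ofReal (Real.exp (w⁻¹ * ∫ s in (0 : ℝ)..w,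
        ∑ i, g ((Φ.flow s z i).2)))
        ∂(localGibbsLaw σ (fun _ => 1) (fun _ => 0) (fun _ => 1) N₀ Φ) =
      ∫⁻ z, ENNReal.ofReal (Real.exp (2 * ∑ i : Fin (N₀ + 1), (w⁻¹ *
        ∫ r in (0 : ℝ)..w, gTilt ((Φ.flow r z) i).2)))
        ∂(localGibbsLaw σ (fun _ => 1) (fun _ => 0) (fun _ => 1) N₀ Φ) :=
    lintegral_congr fun z => by rw [hpt z]
  have key' : ∫⁻ z, ENNReal.ofReal (Real.exp (w⁻¹ * ∫ s in (0 : ℝ)..w,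
        ∑ i, g ((Φ.flow s z i).2)))
        ∂(localGibbsLaw σ (fun _ => 1) (fun _ => 0) (fun _ => 1) N₀ Φ) ≤
      ENNReal.ofReal (Real.exp (1 * ((N₀ : ℝ) + 1))) := hEq.le.trans key
  -- the invariant drift tilt `u₁ = e₀`
  have hΓ := KineticFluxLdDecayWith.gamma_le one_pos (EuclideanSpace.single (0 : Fin 3) (1 : ℝ))
    hgc hgK hwpos key'
  obtain ⟨hc_lo, hc_hi⟩ := exp_neg_half_bounds
  set c : ℝ := Real.exp (-1 / 2) with hc
  have hshift : ∀ v : V3, g (EuclideanSpace.single (0 : Fin 3) (1 : ℝ) + Real.sqrt 1 • v) =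
      16 * (Real.cos (0 + 1 * v 1) - Real.cos (1 + 1 * v 0)) := fun v => by
    simp [hg, gTilt]
    ring
  rw [integral_add (integrable_comp_shift_of_abs_le hgc hgK _ _) (integrable_llr1_comp_shift one_pos _),
    integral_llr1_drift] at hΓ
  simp_rw [hshift] at hΓ
  have hci1 : Integrable (fun v : V3 => Real.cos (0 + 1 * v 1)) (stdGaussian V3) :=
    integrable_of_abs_le_stdGaussian (f := fun v : V3 => Real.cos (0 + 1 * v 1))
      (Real.continuous_cos.comp (continuous_const.add (continuous_const.mul (continuous_coord 1))))
      fun v => Real.abs_cos_le_one _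
  have hci0 : Integrable (fun v : V3 => Real.cos (1 + 1 * v 0)) (stdGaussian V3) :=
    integrable_of_abs_le_stdGaussian (f := fun v : V3 => Real.cos (1 + 1 * v 0))
      (Real.continuous_cos.comp (continuous_const.add (continuous_const.mul (continuous_coord 0))))
      fun v => Real.abs_cos_le_one _
  rw [integral_const_mul, integral_sub hci1 hci0, integral_cos_coord, integral_cos_coord, PiLp.norm_single,
    Real.cos_zero] at hΓ
  simp only [Real.norm_eq_abs, abs_one, one_pow, mul_one] at hΓ
  norm_num at hΓ
  rw [show Real.exp (-(1 / 2) : ℝ) = c by rw [hc]; norm_num] at hΓ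
  have hcos := KineticFluxLdDecayTilt.one_sub_cos_one_ge
  nlinarith [mul_le_mul_of_nonneg_left hcos (by linarith : (0:ℝ) ≤ c)]


/-- **Consequence: every clock typed on the `∀ β` kinetic node is vacuously true** — e.g. ideator 2's
`TaggedNetClock := KineticWindowLDBoundedAllBeta → …` and the 15145 restated clock
`ClampedEntropyClockRestated := KWLDU → KineticWindowLDUniformBounded → …`: provable ex falso, feeding nothing.
[folklore] -/
theorem allBeta_antecedent_vacuous (P : Prop) : KineticWindowLDBoundedAllBeta → P :=
  fun h => absurd h not_kineticWindowLDBoundedAllBeta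

/-! ## §6 Near-miss (paper; not closed this cycle): the `∀ β` COLLISIONAL child is false as well

Target: ideator 2's `LocalClampedTransferWindowLDAllBeta` (`Cruxes/TransferEntropyClock/IdeatorTwoSketch.lean`
§3: the LOCAL transfer-clamped collisional node with `∃ β₀ ∀ |β| ≤ β₀` replaced by `∀ β`), restated verbatim below.

AT CONSTANT PROFILES invariant tilts do not bite: every flow-invariant absolutely continuous tilt of the homogeneous
Gibbs law (drift, temperature, any density `q(Σvᵢ, Σ|vᵢ|²)`) has the translation-invariant one-point position
marginal, so `E[Σᵢ ∂_kφ(xᵢ)·(velocity weights)] = (∫∂_kφ)·(…) = 0`, and `E[X] = 0`: zero gain. (A cold co-moving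
wind with BIASED positions does bite there, but needs the `(N+1)!`-boxes Gibbs lower bound of the 13733 refutation and
pathwise conservation-law control — ≈ 1500 lines.)

THE CHEAP KILL USES THE NODE'S OWN LOCALITY (paper, all ingredients in the tree; ≈ 800 lines, deferred to the re-arm
at which this node becomes a registered target). Instance: `η₀` given; `a ≡ 1`, `θ₀ ≡ 1`, INHOMOGENEOUS VELOCITY
PROFILE `u₀(x) = ψ(x) e₁` with `ψ = ∂₀φ`, `φ = cos 2πx₀` (13733 `Negative/TestFunction.phi`); `σ` small
(`SmallDensity uniformProfile σ`, so `ρ₀ = rhoLim (profileOf 1) σ ≡ 1` by `rhoLim_uniform` + `profileOf_const`, and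
the two `Z′` c-numbers reduce to `σ³Z̄′∫∂₀φ = 0`); any flows; `V = V₀`; `β = ±B`; `ε = 1`; `N = N₀`. Tilt: the
HOMOGENEOUS Gibbs law `G_s` (activity 1, temperature 1, CONSTANT drift `s e₁`) — flow-invariant
(`measurePreserving_flow_localGibbsLaw_const`) with `λ = G_s · Πᵢ M_{ψ(xᵢ)e₁,1}(vᵢ)/M_{se₁,1}(vᵢ)` and EQUAL partition
functions (`canonicalPartition_eq_posPartition`; the x-dependent-drift version of `localGibbsMeasure_ref_eq_withDensity`).
Donsker–Varadhan (`ofReal_exp_le_lintegral_withDensity`) for the momentum row `k = 0`: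
`(N+1)⁻¹ log ∫ e^{β(w⁻¹X − w⁻¹A)} dλ ≥ (N+1)⁻¹(β E_{G_s}[w⁻¹X − w⁻¹A] + E_{G_s}[log dλ/dG_s])`, where
* `|E_{G_s}[w⁻¹X]| ≤ ½‖∇φ‖V(N+1)` — pathwise clamp bound (the `ω_fst ω_snd ≤ ω_fst` twin of
  `ClampedCurrentsDockClampRemainder.abs_collisionSum_unclamped_le_transfer`: contact ⇒ `|φᵢ − φⱼ| ≤ ‖∇φ‖ε_N`,
  `ωᵢ Aᵢ ≤ (τ/σ)V`, `ε_N τ/σ = w`);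
* `E_{G_s}[w⁻¹A₀]/(N+1) = σ³Z̄′·E[∂₀φ(x₁)] + (1/3)(Z̄−1)·E[∂₀φ(x₁)|v₁ − ψ(x₁)e₁|²]` by invariance + Fubini
  (`integral_windowAvg_regFlowCrux` with integrability in place of boundedness — energy conservation
  `HardSphereFlow.configEnergy_flow` bounds `A` pathwise by `w·(C(N+1) + C′Σ|vᵢ(0)|²)`), and with the UNIFORM one-point
  position marginal (`integral_mul_shiftInvariant`) and Gaussian velocities:
  `= 0 + (1/3)(Z̄−1)∫∂₀φ (3 + (s − ψ)²) dx = −(2/3)(Z̄−1)·s·∫(∂₀φ)² = −(4π²/3)(Z̄−1) s` (`∫∂₀φ = ∫(∂₀φ)³ = 0`);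
* `E_{G_s}[log dλ/dG_s]/(N+1) = −½∫(s − ψ)² = −½(s² + 2π²)`.
Hence the per-particle pressure is `≥ β(4π²/3)(Z̄−1)s − |β|πV₀ − ½s² − π²`; at the optimal drift
`s = β(4π²/3)(Z̄−1)` it is `≥ ½β²(4π²/3)²(Z̄−1)² − |β|πV₀ − π² → +∞` as `|β| → ∞` (`Z̄ − 1 = σ³F′(σ³) ≠ 0` by
`HsEosLowDensity`). So `B` large (depending on `V₀, σ` only — both fixed before `∀ β`) contradicts `ε = 1` at every
`τ ≥ τ₀` and `N = N₀`. MORAL (same as §5): the x-FROZEN centring of the local node removes only the FIRST-order response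
to the reference's own profile; a homogeneous tilt across an inhomogeneous `u₀(x)` has a second-order cross term
`−2s∫∂_kφ ψ` that no c-number centres, and `∀ β` lets it beat the quadratic entropy cost. NOT hit: the same node with
`∃ β₀` after `V` (β₀ ≲ 1/((Z̄−1)‖∇φ‖‖u₀‖…)), nor C′ (constant profiles). -/

/-- **(near-miss, sorried) The `∀ β` collisional child is false** — statement: ideator 2's
`LocalClampedTransferWindowLDAllBeta` verbatim; proof: the homogeneous DRIFT tilt across the inhomogeneous velocity
profile `u₀ = (∂₀φ) e₁` described above (all ingredients in the tree; ≈ 800 lines of bookkeeping, deferred to the re-arm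
at which this node is a registered target). Obstruction to closing it this cycle: volume only. [folklore] -/
theorem not_localClampedTransferWindowLDAllBeta :
    ¬ (∃ η₀ : ℝ, 0 < η₀ ∧ ∀ (a θ₀ : T3 → ℝ) (u₀ : T3 → V3) (ha : Continuous a), Continuous θ₀ → Continuous u₀ →
    ∀ (ha0 : ∀ x, 0 < a x), (∀ x, 0 < θ₀ x) → ∀ σ : ℝ, 0 < σ → σ < 1 / 2 → σ ^ 3 * (⨆ x, a x) ≤ η₀ * ∫ x, a x →
    ∀ Φ : (N : ℕ) → HardSphereFlow (Torus.geometry (Fin 3)) (hsDiameter σ N) (N + 1),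
    ∀ φ : T3 → ℝ, Torus.IsSmooth φ →
    ∃ V₀ : ℝ, 0 < V₀ ∧ ∀ V : ℝ, V₀ ≤ V → ∀ β : ℝ, ∀ ε : ℝ, 0 < ε →
    ∃ τ₀ : ℝ, 0 < τ₀ ∧ ∀ τ : ℝ, τ₀ ≤ τ → ∃ N₀ : ℕ, ∀ N : ℕ, N₀ ≤ N →
      (let ρ₀ : T3 → ℝ := rhoLim (profileOf a ha ha0) σ
       let w : ℝ := τ * ((N : ℝ) + 1) ^ (-(1 / 3 : ℝ))
       let P := localGibbsLaw σ a u₀ θ₀ N (Φ N)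
       let Z : T3 → ℝ := fun x => hsCompressibility (ρ₀ x * σ ^ 3)
       let Z' : T3 → ℝ := fun x => deriv hsCompressibility (ρ₀ x * σ ^ 3)
       let act := fun (i : Fin (N + 1)) (z : Config (N + 1) (Fin 3) T3) =>
         σ / τ * (Φ N).collisionSum (Set.Ioc 0 w) (fun c => if c.fst = i then
           ‖c.postVel.1 - c.preVel.1‖ + |‖c.postVel.1‖ ^ 2 - ‖c.preVel.1‖ ^ 2| / 2 else 0) z
       let ω := fun (i : Fin (N + 1)) (z : Config (N + 1) (Fin 3) T3) => if act i z ≤ V then (1 : ℝ) else 0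
       let Xm := fun (k : Fin 3) (z : Config (N + 1) (Fin 3) T3) =>
         (Φ N).collisionSum (Set.Ioc 0 w)
           (fun c => ω c.fst z * ω c.snd z * ((φ c.fstPos - φ c.sndPos) * (c.postVel.1 k - c.preVel.1 k)) / 2) z
       let Am := fun (k : Fin 3) (z : Config (N + 1) (Fin 3) T3) =>
         (∫ r in (0 : ℝ)..w, ∑ i : Fin (N + 1), Torus.partialDeriv k φ ((Φ N).flow r z i).1 *
           (θ₀ ((Φ N).flow r z i).1 * (ρ₀ ((Φ N).flow r z i).1 * σ ^ 3) * Z' ((Φ N).flow r z i).1 +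
             (1 / 3) * (Z ((Φ N).flow r z i).1 - 1) * ‖((Φ N).flow r z i).2 - u₀ ((Φ N).flow r z i).1‖ ^ 2)) -
         w * ((N : ℝ) + 1) * ∫ x, ρ₀ x * Torus.partialDeriv k φ x * (θ₀ x * (ρ₀ x * σ ^ 3) * Z' x)
       let Xe := fun (z : Config (N + 1) (Fin 3) T3) =>
         (Φ N).collisionSum (Set.Ioc 0 w)
           (fun c => ω c.fst z * ω c.snd z *
             ((φ c.fstPos - φ c.sndPos) * ((‖c.postVel.1‖ ^ 2 - ‖c.preVel.1‖ ^ 2) / 2)) / 2) z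
       let Ae := fun (z : Config (N + 1) (Fin 3) T3) =>
         (∫ r in (0 : ℝ)..w, ∑ i : Fin (N + 1),
           ((∑ l : Fin 3, u₀ ((Φ N).flow r z i).1 l * Torus.partialDeriv l φ ((Φ N).flow r z i).1) *
               (θ₀ ((Φ N).flow r z i).1 * (ρ₀ ((Φ N).flow r z i).1 * σ ^ 3) * Z' ((Φ N).flow r z i).1 +
                 (1 / 3) * (Z ((Φ N).flow r z i).1 - 1) * ‖((Φ N).flow r z i).2 - u₀ ((Φ N).flow r z i).1‖ ^ 2) +
             θ₀ ((Φ N).flow r z i).1 * (Z ((Φ N).flow r z i).1 - 1) *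
               (∑ l : Fin 3, Torus.partialDeriv l φ ((Φ N).flow r z i).1 *
                 (((Φ N).flow r z i).2 - u₀ ((Φ N).flow r z i).1) l))) -
         w * ((N : ℝ) + 1) *
           ∫ x, ρ₀ x * (∑ l : Fin 3, u₀ x l * Torus.partialDeriv l φ x) * (θ₀ x * (ρ₀ x * σ ^ 3) * Z' x)
       (∀ k : Fin 3, ∫⁻ z, ENNReal.ofReal (Real.exp (β * (w⁻¹ * Xm k z - w⁻¹ * Am k z))) ∂P ≤
           ENNReal.ofReal (Real.exp (ε * ((N : ℝ) + 1)))) ∧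
         ∫⁻ z, ENNReal.ofReal (Real.exp (β * (w⁻¹ * Xe z - w⁻¹ * Ae z))) ∂P ≤
           ENNReal.ofReal (Real.exp (ε * ((N : ℝ) + 1))))) := by
  sorry

/-! ## §7 What would still kill the crux through its parts (for the sibling seats and later cycles)

* C′ (stmt-16623): immune to homogeneous tilts (above); the clamp bounds every row pathwise by `½‖∇φ‖V(N+1)`,
  and `β₀` is chosen after `V, θ₀, φ, σ`, so an explicit-control witness must gain `> (entropy cost)/β₀` per
  particle at bounded transfer activity — none found (cradle relays, blobs, cages, hot/cold spots, boosts,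
  counter-streaming winds near an interface are all clamped, sub-extensive over the window, or priced by the
  position/velocity entropy). The honest content of C′ is (F1) N-uniform window decorrelation of clamped
  collisional currents beyond Lanford's time and (F2) the tagged-particle transfer-activity LLN; both open.
* `TransferActivityTails` (stmt-16624): see its own `Cruxes/TransferActivityTails/Disproof.lean`.
* The crux dies as a CUT only if its split children die; after §5–§6 the admissible typings of the children are:
  thresholds `β₀` EXPLICIT in `(sup θ, sup|u|, ‖F‖_w, clamp level V, ‖∇φ‖)` and uniform along compact profile
  families and truncation families — strictly between "pointwise" (unconsumable, UNIFORMITY finding) and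
  "∀ β" (false, §5). -/

end Summit.AtomisticToContinuum.HydrodynamicLimit.Cruxes.TransferEntropyClock.Disproof

end
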